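import Literature.MathematicalPhysics.QuantumLattice.HubbardTTPrimeTPPFillingTransport
import Literature.MathematicalPhysics.QuantumLattice.HubbardTTPrimeAnchorWordBoxTransport
import HarnessLib

/-!
# The nearest-neighbour density–density repulsion `V Σ_⟨xy⟩ n_x n_y` as a lattice-fermion interaction,
# its conjugate density `W(ω)` (positivity, kinematic cap, correlator dictionary), and the extended
# `t–t'–U–V` Hubbard interaction on `ℤ²`

Topic `Literature/MathematicalPhysics/QuantumLattice` (family `hubbard`; §1–§2 general dimension `d`).
Written for the material-oracle stage S1/S2 seam (cell `pub/hubbard-downfold`, seat unc-1 = the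
INTERACTION direction of the parameter box): an ab-initio one-band box of a cuprate / nickelate carries,
besides `U`, the nearest-neighbour repulsion `V` (cRPA: `V₁/U ≈ 0.2–0.25`; the coordinate `VOverT` of
`Summit.Ventures.CertifiedManyBodySolver.Downfold.OneBandCoord`, read by no tree object before this file),
while every word certified downstream is a word about the U-only `t–t'` model. This file supplies the
missing OBJECT — the `V` term as an even finite-range `FermionInteraction` in the infinite-volume formalism
in which S2 words are stated — and the two structural facts every transport rule in `V` needs about its
conjugate density; the companion `HubbardTTPrimeNNRepulsionTransport.lean` turns them into the
`V`-direction BOX → WORD rules (U-only floors hold for the `U–V` model; caps = U-only cap + `V` × a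
nearest-neighbour word; the per-site, fixed-filling face of the Peierls–Feynman–Bogoliubov enclosure
`PFB.groundEnergy_ext_mem_Icc` of `OptimalLocalHubbardMapping.lean`).

* §1 **`nnRepulsionFermionInteraction d V`** — `Φ_V {x, x + e_i} = V · n_x n_{x+e_i}`
  (`n_x = n_{x↑} + n_{x↓}`), `0` on every other set (Schüler et al. 2013 Eq. (1) with `V_ij = V` on
  nearest-neighbour bonds): even, Hermitian, linear in `V` (`_smul_apply`, `_zero_apply`), the bond term
  (`_apply_pair`), vanishing lemmas (`_apply_eq_zero`, `_apply_singleton`), and its mean-energy observable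
  `E_{Φ_V} = Σ_i (½Γ(Φ_V{0,e_i}) + ½Γ(Φ_V{−e_i,0}))` at range `1` (`nnRepulsionFermionInteraction_meanEnergyObs`).
* §2 THE CONJUGATE DENSITY `W(ω) := e_{Φ_1}(ω)` (nearest-neighbour density–density energy per site):
  scaling `e_{Φ_V} = V·W` and range-independence (`R ≥ 1`); the local algebra
  `n_x² = n_x + 2n_{x↑}n_{x↓}`, `0 ≤ Re ω(n_x n_y)` (four commuting projections) and
  `2 Re ω(n_x n_y) ≤ Re ω(n_x²) + Re ω(n_y²)` (`(n_x − n_y)⋆(n_x − n_y) ≥ 0`) for EVERY state; hence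
  **`W(ω) ≥ 0` for every state** (`meanEnergy_nnRepulsion_one_nonneg` — the infinite-volume face of
  `V̂ ⪰ 0`) and, for every TRANSLATION-INVARIANT state, **`W(ω) ≤ d·(ρ(ω) + 2D(ω))`**,
  `D(ω) = Re ω(n_{0↑}n_{0↓})` (`IsTranslationInvariant.meanEnergy_nnRepulsion_one_le`; with a certified
  docc ceiling this is the «docc-word edition» of a nearest-neighbour word), `0 ≤ W ≤ 4ρ` on `ℤ²`
  (`_mem_Icc`, `D ≤ ρ/2`), and the DICTIONARY `W(ω) = Σ_i Re ω(n_0 n_{e_i})`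
  (`IsTranslationInvariant.meanEnergy_nnRepulsion_one_eq_sum`, bond expectations are bond-independent) —
  the form in which a certificate engine would certify `W ≤ Whi`.
* §3 **`hubbardTT'VFermionInteraction t t' U V`** — THE EXTENDED `t–t'–U–V` HUBBARD INTERACTION of the
  square lattice, by definition the pencil `Φ(t,t',U) + V·Φ_1`: its terms, evenness, Hermiticity, `V = 0`,
  `E^{tt'UV} = E^{tt'U} + V·E^{Φ_1}`, and the mean energy `e^{tt'UV}(ω) = e^{tt'U}(ω) + V·W(ω)`, affine in
  `U` as well (`meanEnergy_hubbardTT'V_affine_U`, slope the double-occupancy density).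

Everything is PROVED; two definitions with bodies (`nnRepulsionFermionInteraction`,
`hubbardTT'VFermionInteraction`); no named fact, no number, no `sorry`. HONEST SCOPE: the object and its
kinematics only — nothing here is a torus thermodynamic-limit statement for `V ≠ 0` (the fixed-filling
variational density `tiGroundEnergyDensityAt` of the companion file is identified with Ruelle's limit at
`V = 0` only), and nothing bears on order / pairing words.

## Mathlib / tree search

REUSED (cited, not restated): `FermionInteraction.pencil`, `pencil_apply`, `meanEnergy_pencil`,
`isEven_pencil`, `isHermitian_pencil`, `pencil_zero_apply`, `meanEnergyObs_pencil`
(`TIGroundEnergyDensityResponse`); `FermionInteraction.ext` (`TIGroundEnergyDensityCouplingFamilies`);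
`FermionInteraction.meanEnergyObs_eq_sum`, `meanEnergyObs_of_smul`, `pair_[neg_]unitVec_subset_thicken_one`,
`self_ne_add_unitVec`, `add_unitVec_add_unitVec_ne_self`, `uvec_ne_zero`, `uvec_injective`,
`uvec_add_uvec_ne_zero` (`HubbardFermionInteractionTerms`, `HubbardTTPrimeMeanEnergySupergradient`);
`InfVolFermionState.meanEnergy_eq_of_le` (`HubbardTTPrimeTPPFillingTransport` §1);
`isHermitian_isIdempotentElem_mul_of_commute`, `re_expect_nonneg_of_isHermitian_of_isIdempotentElem`,
`shiftSet_singleton_zero_subset`, `shiftSet_pair_zero_subset` (`HubbardEnergyDensityChemicalPotential`,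
`InfVolFermionStateHubbardMeanEnergyBox`); `meanEnergy_hubbardTTPrime_affine`,
`meanEnergy_hubbardTTPrime_onSite_eq_re_expect_docc`, `_onSite_le_half_density`
(`HubbardTTPrimeMeanEnergySupergradient`, `HubbardTTPrimeAnchorWordBoxTransport`); `numberAt_commute`,
`numberAt_isHermitian`, `numberAt_idempotent`, `InfVolFermionState.expect_nonneg`, `compatible`,
`expect_fermionEmbed_incl_eq`, `shift_expect`. Template: `hubbardFermionInteraction_meanEnergyObs`,
`vectorHoppingFermionInteraction` (`LatticeVectorHoppingInteraction`).
`lean search 'extendedHubbard|hubbardUV|densityDensity|nnRepulsion|hubbardTT.V' --decl`: no hits (2026-08-27).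

## References

* M. Schüler, M. Rösner, T. O. Wehling, A. I. Lichtenstein, M. I. Katsnelson, PRL 111 (2013) 036601,
  Eq. (1) (the extended Hubbard Hamiltonian `H = −Σ t_ij c†c + UΣ n↑n↓ + ½Σ V_ij n_i n_j`).
  [cite: SchulerEtAl2013, Eq. (1)]
* E. G. C. P. van Loon, M. Schüler, M. I. Katsnelson, T. O. Wehling, PRB 94 (2016) 165141, §2
  (nearest-neighbour `V` and the local mapping `Ũ = U − αV`). [cite: vanLoonEtAl2016, §2 Eqs. (5)–(6)]
* T. Koma, H. Tasaki, J. Stat. Phys. 76 (1994) 745, §1 (energies affine in a linear coupling; the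
  conjugate observable). [cite: KomaTasaki1994, §1]
* O. Bratteli, A. Kishimoto, D. W. Robinson, CMP 64 (1978) 41, §3 (mean energy functional).
  [cite: BratteliKishimotoRobinson1978, §3 (mean energy functional)]
* O. Bratteli, D. W. Robinson, *OAQSM 1* (1987), §2.3.2 (positivity of states), §4.3.1 (invariant states).
  [cite: BratteliRobinsonI1987, §2.3.2]
* H. Araki, H. Moriya, Rev. Math. Phys. 15 (2003) 93, §4.1, §5.1 (local CAR algebras; even finite-range
  potentials). [cite: ArakiMoriya2003, §5.1]
* D. Ruelle, *Statistical Mechanics* (1969), §3.4 (densities of translation-invariant states).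
  [cite: Ruelle1969, §3.4]
-/

noncomputable section

namespace Literature.MathematicalPhysics.QuantumLattice

open Matrix Finset HubbardWave0 Literature.Probability.LatticeModels ThermodynamicLimit
open _root_.Filter
open scoped _root_.Topology ComplexOrder BigOperators

variable {d : ℕ}

/-! ### §1. The nearest-neighbour density–density interaction -/

/-- **The nearest-neighbour density–density repulsion on `ℤ^d`** with amplitude `V`:
`Φ_V {x, x + e_i} = V · n_x n_{x+e_i}` with `n_x = n_{x↑} + n_{x↓}`, and `Φ_V X = 0` for every other
finite region `X` — an even Hermitian `FermionInteraction d` of range `1`; the `V_ij = V δ_{|i−j|,1}` part of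
the extended Hubbard Hamiltonian `½ Σ_{i≠j} V_ij n_i n_j` (each unoriented bond once).
[cite: SchulerEtAl2013, Eq. (1)] -/
def nnRepulsionFermionInteraction (d : ℕ) (V : ℝ) : FermionInteraction d where
  Φ X :=
    ∑ x ∈ X.attach, ∑ y ∈ X.attach,
      if (∃ i : Fin d, y.1 = x.1 + unitVec i) ∧ X = {x.1, y.1} then
        (V : ℂ) • ((nAt x.1 x.2 0 + nAt x.1 x.2 1) * (nAt y.1 y.2 0 + nAt y.1 y.2 1))
      else 0

/-- **The nearest-neighbour repulsion is even** (a polynomial in number operators).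
[cite: ArakiMoriya2003, §5.1] -/
theorem nnRepulsionFermionInteraction_isEven (V : ℝ) : (nnRepulsionFermionInteraction d V).IsEven := by
  intro X
  have hn : ∀ (x : Site d) (hx : x ∈ X) (σ : Fin 2), parityAut (nAt x hx σ) = nAt x hx σ := by
    intro x hx σ
    rw [nAt, numberOp, map_mul, parityAut_creation, parityAut_annihilation, neg_mul_neg]
  simp only [nnRepulsionFermionInteraction, map_sum, apply_ite parityAut, map_zero, map_smul, map_mul,
    map_add, hn]

/-- **The nearest-neighbour repulsion is Hermitian** (real amplitude; the two site densities commute).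
[cite: SchulerEtAl2013, Eq. (1)] -/
theorem nnRepulsionFermionInteraction_isHermitian (V : ℝ) :
    (nnRepulsionFermionInteraction d V).IsHermitian := by
  intro X
  have hn : ∀ (x : Site d) (hx : x ∈ X) (σ : Fin 2), (nAt x hx σ)ᴴ = nAt x hx σ := by
    intro x hx σ
    rw [nAt, ← numberAt_orb]
    exact (numberAt_isHermitian _).eq
  have hc : ∀ (x y : Site d) (hx : x ∈ X) (hy : y ∈ X) (σ τ : Fin 2),
      Commute (nAt x hx σ) (nAt y hy τ) := by
    intro x y hx hy σ τ
    rw [nAt, nAt, ← numberAt_orb, ← numberAt_orb]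
    exact numberAt_commute _ _
  have hprod : ∀ (x y : Site d) (hx : x ∈ X) (hy : y ∈ X),
      ((nAt x hx 0 + nAt x hx 1) * (nAt y hy 0 + nAt y hy 1))ᴴ =
        (nAt x hx 0 + nAt x hx 1) * (nAt y hy 0 + nAt y hy 1) := by
    intro x y hx hy
    have hcomm : Commute (nAt x hx 0 + nAt x hx 1) (nAt y hy 0 + nAt y hy 1) :=
      ((hc x y hx hy 0 0).add_right (hc x y hx hy 0 1)).add_left
        ((hc x y hx hy 1 0).add_right (hc x y hx hy 1 1))
    rw [Matrix.conjTranspose_mul, Matrix.conjTranspose_add, Matrix.conjTranspose_add, hn, hn, hn, hn]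
    exact hcomm.eq.symm
  unfold Matrix.IsHermitian nnRepulsionFermionInteraction
  simp only [Matrix.conjTranspose_sum, apply_ite Matrix.conjTranspose, Matrix.conjTranspose_zero,
    Matrix.conjTranspose_smul, hprod, Complex.star_def, Complex.conj_ofReal]

/-- **Scaling in the amplitude** (the pencil hook): `Φ_{c·V} X = c • Φ_V X`; in particular
`Φ_V = V • Φ_1`. [cite: SchulerEtAl2013, Eq. (1)] -/
theorem nnRepulsionFermionInteraction_smul_apply (c V : ℝ) (X : Finset (Site d)) :
    (nnRepulsionFermionInteraction d (c * V)).Φ X = (c : ℂ) • (nnRepulsionFermionInteraction d V).Φ X := by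
  simp only [nnRepulsionFermionInteraction, Finset.smul_sum, smul_ite, smul_zero, smul_smul, Complex.ofReal_mul]

/-- At amplitude `0` every term vanishes. [cite: SchulerEtAl2013, Eq. (1)] -/
theorem nnRepulsionFermionInteraction_zero_apply (X : Finset (Site d)) :
    (nnRepulsionFermionInteraction d 0).Φ X = 0 := by
  have h := nnRepulsionFermionInteraction_smul_apply (d := d) 0 1 X
  rwa [zero_mul, Complex.ofReal_zero, zero_smul] at h

section Terms

variable (V : ℝ)

/-- **Bond term**: `Φ_V {x, x + e_i} = V · (n_{x↑} + n_{x↓})(n_{x+e_i,↑} + n_{x+e_i,↓})`.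
[cite: SchulerEtAl2013, Eq. (1)] -/
theorem nnRepulsionFermionInteraction_apply_pair (x : Site d) (i : Fin d) :
    (nnRepulsionFermionInteraction d V).Φ {x, x + unitVec i} =
      (V : ℂ) • ((nAt x (mem_insert_self _ _) 0 + nAt x (mem_insert_self _ _) 1) *
        (nAt (x + unitVec i) (mem_insert_of_mem (mem_singleton_self _)) 0 +
          nAt (x + unitVec i) (mem_insert_of_mem (mem_singleton_self _)) 1)) := by
  have hmem : ∀ {a : Site d}, a ∈ ({x, x + unitVec i} : Finset (Site d)) ↔ a = x ∨ a = x + unitVec i :=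
    fun {a} => by rw [mem_insert, mem_singleton]
  simp only [nnRepulsionFermionInteraction]
  rw [Finset.sum_eq_single ⟨x, mem_insert_self _ _⟩]
  · rw [Finset.sum_eq_single ⟨x + unitVec i, mem_insert_of_mem (mem_singleton_self _)⟩, if_pos ⟨⟨i, rfl⟩, rfl⟩]
    · rintro ⟨b, hb⟩ - hne
      refine if_neg ?_
      rintro ⟨⟨j, hj⟩, -⟩
      rcases hmem.1 hb with rfl | rfl
      · exact self_ne_add_unitVec _ j hj
      · exact hne rfl
    · intro h
      exact absurd (mem_attach _ _) h
  · rintro ⟨a, ha⟩ - hne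
    refine Finset.sum_eq_zero fun b _ => if_neg ?_
    rintro ⟨⟨j, hj⟩, -⟩
    rcases hmem.1 ha with rfl | rfl
    · exact hne rfl
    · rcases hmem.1 b.2 with hb | hb
      · exact add_unitVec_add_unitVec_ne_self _ i j (hj.symm.trans hb)
      · exact self_ne_add_unitVec _ j (hb.symm.trans hj)
  · intro h
    exact absurd (mem_attach _ _) h

/-- **All other terms vanish**: if `X` is not a nearest-neighbour pair `{x, x + e_i}`, `Φ_V X = 0`.
[cite: SchulerEtAl2013, Eq. (1)] -/
theorem nnRepulsionFermionInteraction_apply_eq_zero {X : Finset (Site d)}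
    (h2 : ∀ (x : Site d) (i : Fin d), X ≠ {x, x + unitVec i}) :
    (nnRepulsionFermionInteraction d V).Φ X = 0 := by
  have hB : ∀ a b : Site d, ¬ ((∃ i : Fin d, b = a + unitVec i) ∧ X = {a, b}) := by
    rintro a b ⟨⟨i, rfl⟩, h⟩
    exact h2 a i h
  simp only [nnRepulsionFermionInteraction, hB, if_false, sum_const_zero]

/-- The nearest-neighbour repulsion has no on-site term: `Φ_V {x} = 0`. [cite: SchulerEtAl2013, Eq. (1)] -/
theorem nnRepulsionFermionInteraction_apply_singleton (x : Site d) :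
    (nnRepulsionFermionInteraction d V).Φ {x} = 0 := by
  refine nnRepulsionFermionInteraction_apply_eq_zero V fun y i h => ?_
  have := congrArg Finset.card h
  rw [card_singleton, card_pair (self_ne_add_unitVec y i)] at this
  exact absurd this (by norm_num)

end Terms

/-! #### The mean-energy observable `E_{Φ_V} = Σ_i (½Γ(Φ_V{0,e_i}) + ½Γ(Φ_V{−e_i,0}))` -/

section MeanEnergyObs

variable (V : ℝ)

/-- **The mean-energy observable of the nearest-neighbour repulsion** (range `1`): in `𝔄_{[-1,1]^d}`,
`E_{Φ_V} = Σ_i (½ Γ(Φ_V{0, e_i}) + ½ Γ(Φ_V{-e_i, 0}))`, one half of each of the `2d` nearest-neighbour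
bonds through the origin (every other `X ∋ 0` carries `Φ_V X = 0`).
[cite: BratteliKishimotoRobinson1978, §3 (mean energy functional)] -/
theorem nnRepulsionFermionInteraction_meanEnergyObs :
    (nnRepulsionFermionInteraction d V).meanEnergyObs 1 =
      ∑ i : Fin d,
        ((2 : ℂ)⁻¹ • fermionEmbed (PolySite.incl (pair_unitVec_subset_thicken_one i))
            ((nnRepulsionFermionInteraction d V).Φ {0, 0 + unitVec i}) +
          (2 : ℂ)⁻¹ • fermionEmbed (PolySite.incl (pair_neg_unitVec_subset_thicken_one i))
            ((nnRepulsionFermionInteraction d V).Φ {-unitVec i, -unitVec i + unitVec i})) := by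
  classical
  set T : Finset (Site d) := thicken ({0} : Finset (Site d)) 1 with hT
  set F : Finset (Site d) → FermionOp T := fun X =>
    if h : X ⊆ T then ((X.card : ℂ)⁻¹) • fermionEmbed (PolySite.incl h) ((nnRepulsionFermionInteraction d V).Φ X)
    else 0 with hF
  rw [FermionInteraction.meanEnergyObs_eq_sum]
  change ∑ X ∈ T.powerset with (0 : Site d) ∈ X, F X = _
  -- the support: `{0, e_i}`, `{-e_i, 0}`
  set S' : Finset (Finset (Site d)) :=
    (univ.image fun i : Fin d => ({0, 0 + unitVec i} : Finset (Site d))) ∪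
      univ.image fun i : Fin d => ({-unitVec i, -unitVec i + unitVec i} : Finset (Site d)) with hS'
  have hS'sub : S' ⊆ T.powerset.filter fun X => (0 : Site d) ∈ X := by
    intro X hX
    rw [hS', mem_union, mem_image, mem_image] at hX
    rw [mem_filter, mem_powerset]
    rcases hX with ⟨i, -, rfl⟩ | ⟨i, -, rfl⟩
    · exact ⟨pair_unitVec_subset_thicken_one i, mem_insert_self _ _⟩
    · refine ⟨pair_neg_unitVec_subset_thicken_one i, ?_⟩
      rw [neg_add_cancel]
      exact mem_insert_of_mem (mem_singleton_self _)
  have hzero : ∀ X ∈ T.powerset.filter (fun X => (0 : Site d) ∈ X), X ∉ S' → F X = 0 := by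
    intro X hX hXS
    rw [mem_filter, mem_powerset] at hX
    have hΦ : (nnRepulsionFermionInteraction d V).Φ X = 0 := by
      refine nnRepulsionFermionInteraction_apply_eq_zero V (fun x i hx => hXS ?_)
      have h0 := hX.2
      rw [hx, mem_insert, mem_singleton] at h0
      rw [hS', hx, mem_union, mem_image, mem_image]
      rcases h0 with h0 | h0
      · exact Or.inl ⟨i, mem_univ _, by rw [← h0, zero_add]⟩
      · refine Or.inr ⟨i, mem_univ _, ?_⟩
        have : x = -unitVec i := eq_neg_of_add_eq_zero_left h0.symm
        rw [this]
    simp only [hF, hΦ, map_zero, smul_zero, dite_eq_ite, ite_self]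
  rw [← Finset.sum_subset hS'sub hzero]
  have hdisj : Disjoint (univ.image fun i : Fin d => ({0, 0 + unitVec i} : Finset (Site d)))
      (univ.image fun i : Fin d => ({-unitVec i, -unitVec i + unitVec i} : Finset (Site d))) := by
    rw [disjoint_iff_ne]
    rintro X hX Y hY rfl
    rw [mem_image] at hX hY
    obtain ⟨i, -, rfl⟩ := hX
    obtain ⟨j, -, hj⟩ := hY
    have hmem : -unitVec j ∈ ({0, 0 + unitVec i} : Finset (Site d)) := hj ▸ mem_insert_self _ _
    rw [mem_insert, mem_singleton, zero_add, neg_eq_zero] at hmem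
    rcases hmem with h | h
    · exact uvec_ne_zero j h
    · exact uvec_add_uvec_ne_zero j i (show unitVec j + unitVec i = 0 by rw [← h, add_neg_cancel])
  have hinj1 : Set.InjOn (fun i : Fin d => ({0, 0 + unitVec i} : Finset (Site d))) ↑(univ : Finset (Fin d)) := by
    intro i _ j _ h
    dsimp only at h
    have hmem : 0 + unitVec i ∈ ({0, 0 + unitVec j} : Finset (Site d)) := h ▸ mem_insert_of_mem (mem_singleton_self _)
    rw [mem_insert, mem_singleton, zero_add, zero_add] at hmem
    rcases hmem with h' | h'
    · exact absurd h' (uvec_ne_zero i)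
    · exact uvec_injective h'
  have hinj2 : Set.InjOn (fun i : Fin d => ({-unitVec i, -unitVec i + unitVec i} : Finset (Site d)))
      ↑(univ : Finset (Fin d)) := by
    intro i _ j _ h
    dsimp only at h
    have hmem : -unitVec i ∈ ({-unitVec j, -unitVec j + unitVec j} : Finset (Site d)) := by
      have : -unitVec i ∈ ({-unitVec i, -unitVec i + unitVec i} : Finset (Site d)) := mem_insert_self _ _
      rwa [h] at this
    rw [mem_insert, mem_singleton, neg_add_cancel, neg_inj, neg_eq_zero] at hmem
    rcases hmem with h' | h'
    · exact uvec_injective h'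
    · exact absurd h' (uvec_ne_zero i)
  rw [hS', Finset.sum_union hdisj, Finset.sum_image hinj1, Finset.sum_image hinj2, ← Finset.sum_add_distrib]
  have h1T : ∀ i : Fin d, ({0, 0 + unitVec i} : Finset (Site d)) ⊆ T := fun i =>
    pair_unitVec_subset_thicken_one i
  have h2T : ∀ i : Fin d, ({-unitVec i, -unitVec i + unitVec i} : Finset (Site d)) ⊆ T := fun i =>
    pair_neg_unitVec_subset_thicken_one i
  have hF1 : ∀ i : Fin d, F {0, 0 + unitVec i} =
      (2 : ℂ)⁻¹ • fermionEmbed (PolySite.incl (h1T i)) ((nnRepulsionFermionInteraction d V).Φ {0, 0 + unitVec i}) := by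
    intro i
    simp only [hF]
    rw [dif_pos (h1T i), card_pair (self_ne_add_unitVec (0 : Site d) i), Nat.cast_ofNat]
  have hF2 : ∀ i : Fin d, F {-unitVec i, -unitVec i + unitVec i} =
      (2 : ℂ)⁻¹ • fermionEmbed (PolySite.incl (h2T i))
        ((nnRepulsionFermionInteraction d V).Φ {-unitVec i, -unitVec i + unitVec i}) := by
    intro i
    simp only [hF]
    rw [dif_pos (h2T i), card_pair (self_ne_add_unitVec (-unitVec i : Site d) i), Nat.cast_ofNat]
  exact Finset.sum_congr rfl fun i _ => by rw [hF1, hF2]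

end MeanEnergyObs

/-! ### §2. The conjugate density `W(ω) = e_{Φ_1}(ω)`: scaling, range, positivity, kinematic cap -/

section ConjugateDensity

/-- Number operators of one region commute. [cite: ArakiMoriya2003, §5.1] -/
private theorem commute_nAt {Λ : Finset (Site d)} {x y : Site d} (hx : x ∈ Λ) (hy : y ∈ Λ)
    (σ τ : Fin 2) : Commute (nAt x hx σ) (nAt y hy τ) := by
  rw [nAt, nAt, ← numberAt_orb, ← numberAt_orb]
  exact numberAt_commute _ _

/-- Number operators are Hermitian. [cite: ArakiMoriya2003, §5.1] -/
private theorem isHermitian_nAt {Λ : Finset (Site d)} {x : Site d} (hx : x ∈ Λ) (σ : Fin 2) :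
    (nAt x hx σ).IsHermitian := by
  rw [nAt, ← numberAt_orb]
  exact numberAt_isHermitian _

/-- Number operators are idempotent. [cite: ArakiMoriya2003, §5.1] -/
private theorem isIdempotentElem_nAt {Λ : Finset (Site d)} {x : Site d} (hx : x ∈ Λ) (σ : Fin 2) :
    IsIdempotentElem (nAt x hx σ) := by
  rw [nAt, ← numberAt_orb]
  exact numberAt_idempotent _

/-- **`n_x² = n_x + 2 n_{x↑} n_{x↓}`** for the site density `n_x = n_{x↑} + n_{x↓}` (commuting
projections). [cite: ArakiMoriya2003, §5.1] -/
theorem density_mul_density_self {Λ : Finset (Site d)} {x : Site d} (hx : x ∈ Λ) :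
    (nAt x hx 0 + nAt x hx 1) * (nAt x hx 0 + nAt x hx 1) =
      (nAt x hx 0 + nAt x hx 1) + (2 : ℂ) • (nAt x hx 0 * nAt x hx 1) := by
  rw [add_mul, mul_add, mul_add, (isIdempotentElem_nAt hx 0).eq, (isIdempotentElem_nAt hx 1).eq,
    (commute_nAt hx hx 1 0).eq, two_smul]
  abel

namespace InfVolFermionState

variable (ω : InfVolFermionState d)

/-- **`0 ≤ Re ω(n_x n_y)`** for every state and any two sites of a region (`n_x = n_{x↑} + n_{x↓}`):
the product is the sum of the four commuting projections `n_{xσ} n_{yτ}`.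
[cite: BratteliRobinsonI1987, §2.3.2] -/
theorem re_expect_density_mul_density_nonneg {Λ : Finset (Site d)} {x y : Site d} (hx : x ∈ Λ)
    (hy : y ∈ Λ) : 0 ≤ (ω.expect Λ ((nAt x hx 0 + nAt x hx 1) * (nAt y hy 0 + nAt y hy 1))).re := by
  have hP : ∀ σ τ : Fin 2, 0 ≤ (ω.expect Λ (nAt x hx σ * nAt y hy τ)).re := by
    intro σ τ
    have h := isHermitian_isIdempotentElem_mul_of_commute (commute_nAt hx hy σ τ)
      (isHermitian_nAt hx σ) (isIdempotentElem_nAt hx σ) (isHermitian_nAt hy τ) (isIdempotentElem_nAt hy τ)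
    exact ω.re_expect_nonneg_of_isHermitian_of_isIdempotentElem Λ h.1 h.2
  rw [add_mul, mul_add, mul_add, map_add, map_add, map_add, Complex.add_re, Complex.add_re,
    Complex.add_re]
  have h00 := hP 0 0
  have h01 := hP 0 1
  have h10 := hP 1 0
  have h11 := hP 1 1
  linarith

/-- **`2 Re ω(n_x n_y) ≤ Re ω(n_x²) + Re ω(n_y²)`** for every state: `(n_x − n_y)⋆(n_x − n_y) ≥ 0`
with `n_x`, `n_y` commuting Hermitian. [cite: BratteliRobinsonI1987, §2.3.2] -/
theorem two_mul_re_expect_density_mul_density_le {Λ : Finset (Site d)} {x y : Site d} (hx : x ∈ Λ)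
    (hy : y ∈ Λ) :
    2 * (ω.expect Λ ((nAt x hx 0 + nAt x hx 1) * (nAt y hy 0 + nAt y hy 1))).re ≤
      (ω.expect Λ ((nAt x hx 0 + nAt x hx 1) * (nAt x hx 0 + nAt x hx 1))).re +
        (ω.expect Λ ((nAt y hy 0 + nAt y hy 1) * (nAt y hy 0 + nAt y hy 1))).re := by
  set A : FermionOp Λ := nAt x hx 0 + nAt x hx 1 with hA
  set B : FermionOp Λ := nAt y hy 0 + nAt y hy 1 with hB
  have hAh : Aᴴ = A := by
    rw [hA, Matrix.conjTranspose_add, (isHermitian_nAt hx 0).eq, (isHermitian_nAt hx 1).eq]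
  have hBh : Bᴴ = B := by
    rw [hB, Matrix.conjTranspose_add, (isHermitian_nAt hy 0).eq, (isHermitian_nAt hy 1).eq]
  have hcomm : Commute A B :=
    ((commute_nAt hx hy 0 0).add_right (commute_nAt hx hy 0 1)).add_left
      ((commute_nAt hx hy 1 0).add_right (commute_nAt hx hy 1 1))
  have h := ω.expect_nonneg Λ (A - B)
  rw [Matrix.conjTranspose_sub, hAh, hBh, sub_mul, mul_sub, mul_sub, ← hcomm.eq, map_sub, map_sub,
    map_sub] at h
  have hre := (Complex.nonneg_iff.1 h).1
  simp only [Complex.sub_re] at hre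
  linarith

/-- Moving a one-site density into a larger region: `ω_Λ(n_{xσ}) = ω_{{x}}(n_{xσ})`. [folklore] -/
private theorem expect_nAt_eq_singleton {Λ : Finset (Site d)} {x : Site d} (hx : x ∈ Λ) (σ : Fin 2) :
    ω.expect Λ (nAt x hx σ) = ω.expect {x} (nAt x (mem_singleton_self x) σ) := by
  rw [← ω.compatible (singleton_subset_iff.2 hx) (nAt x (mem_singleton_self x) σ)]
  simp only [nAt, fermionEmbed_numberOp, PolySite.incl_pt]

/-- Moving a one-site double occupancy into a larger region. [folklore] -/
private theorem expect_docc_eq_singleton {Λ : Finset (Site d)} {x : Site d} (hx : x ∈ Λ) :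
    ω.expect Λ (nAt x hx 0 * nAt x hx 1) =
      ω.expect {x} (nAt x (mem_singleton_self x) 0 * nAt x (mem_singleton_self x) 1) := by
  rw [← ω.compatible (singleton_subset_iff.2 hx) (nAt x (mem_singleton_self x) 0 * nAt x (mem_singleton_self x) 1)]
  simp only [nAt, map_mul, fermionEmbed_numberOp, PolySite.incl_pt]

/-- **`Re ω(n_x²) = ρ(x) + 2 Re ω(n_{x↑}n_{x↓})`** in any region containing `x`. [cite: ArakiMoriya2003, §4.1] -/
theorem re_expect_density_sq_eq {Λ : Finset (Site d)} {x : Site d} (hx : x ∈ Λ) :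
    (ω.expect Λ ((nAt x hx 0 + nAt x hx 1) * (nAt x hx 0 + nAt x hx 1))).re =
      ω.densityAt x + 2 * (ω.expect {x} (nAt x (mem_singleton_self x) 0 * nAt x (mem_singleton_self x) 1)).re := by
  rw [density_mul_density_self hx, map_add, map_add, map_smul, ω.expect_nAt_eq_singleton hx,
    ω.expect_nAt_eq_singleton hx, ω.expect_docc_eq_singleton hx, InfVolFermionState.densityAt, map_add,
    Complex.add_re, Complex.add_re, smul_eq_mul, Complex.mul_re]
  simp

/-- For translation-invariant `ω` the one-site densities do not depend on the site (general `d`).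
[cite: ArakiMoriya2003, §4.1 Def. 4.5] -/
private theorem IsTranslationInvariant.expect_nAt_singleton {ω : InfVolFermionState d}
    (hω : ω.IsTranslationInvariant) (x : Site d) (σ : Fin 2) :
    ω.expect {x} (nAt x (mem_singleton_self x) σ) = ω.expect {0} (nAt 0 (mem_singleton_self 0) σ) := by
  conv_rhs => rw [← hω x, shift_expect]
  refine ω.expect_fermionEmbed_incl_eq (subset_refl {x}) (shiftSet_singleton_zero_subset x) _ _ ?_
  have hpt : ∀ (h : 0 + x ∈ ({x} : Finset (Site d))) (h' : x ∈ ({x} : Finset (Site d))),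
      (PolySite.pt (0 + x) h : PolySite ({x} : Finset (Site d))) = PolySite.pt x h' := fun h h' =>
    Subtype.ext (congrArg toLex (zero_add x))
  simp only [fermionEmbed_numberOp, PolySite.shiftEmb_pt, PolySite.incl_pt]
  rw [hpt _ (mem_singleton_self x)]

/-- For translation-invariant `ω` the one-site double occupancy does not depend on the site.
[cite: ArakiMoriya2003, §4.1 Def. 4.5] -/
theorem IsTranslationInvariant.expect_docc_singleton {ω : InfVolFermionState d}
    (hω : ω.IsTranslationInvariant) (x : Site d) :
    ω.expect {x} (nAt x (mem_singleton_self x) 0 * nAt x (mem_singleton_self x) 1) =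
      ω.expect {0} (nAt 0 (mem_singleton_self 0) 0 * nAt 0 (mem_singleton_self 0) 1) := by
  conv_rhs => rw [← hω x, shift_expect]
  refine ω.expect_fermionEmbed_incl_eq (subset_refl {x}) (shiftSet_singleton_zero_subset x) _ _ ?_
  have hpt : ∀ (h : 0 + x ∈ ({x} : Finset (Site d))) (h' : x ∈ ({x} : Finset (Site d))),
      (PolySite.pt (0 + x) h : PolySite ({x} : Finset (Site d))) = PolySite.pt x h' := fun h h' =>
    Subtype.ext (congrArg toLex (zero_add x))
  simp only [map_mul, fermionEmbed_numberOp, PolySite.shiftEmb_pt, PolySite.incl_pt]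
  rw [hpt _ (mem_singleton_self x)]

/-- **The density of a translation-invariant state does not depend on the site**: `ρ(x) = ρ`.
[cite: ArakiMoriya2003, §4.1 Def. 4.5] -/
theorem IsTranslationInvariant.densityAt_eq_density {ω : InfVolFermionState d}
    (hω : ω.IsTranslationInvariant) (x : Site d) : ω.densityAt x = ω.density := by
  rw [InfVolFermionState.density, InfVolFermionState.densityAt, InfVolFermionState.densityAt, map_add,
    map_add, hω.expect_nAt_singleton x 0, hω.expect_nAt_singleton x 1]

/-- **The bond density–density expectation of a translation-invariant state is at most `ρ + 2D`**:
`Re ω(n_x n_y) ≤ ρ(ω) + 2 Re ω(n_{0↑}n_{0↓})` for any two sites of a region.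
[cite: BratteliRobinsonI1987, §2.3.2] -/
theorem IsTranslationInvariant.re_expect_density_mul_density_le {ω : InfVolFermionState d}
    (hω : ω.IsTranslationInvariant) {Λ : Finset (Site d)} {x y : Site d} (hx : x ∈ Λ) (hy : y ∈ Λ) :
    (ω.expect Λ ((nAt x hx 0 + nAt x hx 1) * (nAt y hy 0 + nAt y hy 1))).re ≤
      ω.density + 2 * (ω.expect {0} (nAt (0 : Site d) (mem_singleton_self 0) 0 * nAt 0 (mem_singleton_self 0) 1)).re := by
  have h := ω.two_mul_re_expect_density_mul_density_le hx hy
  rw [ω.re_expect_density_sq_eq hx, ω.re_expect_density_sq_eq hy, hω.densityAt_eq_density x,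
    hω.densityAt_eq_density y, hω.expect_docc_singleton x, hω.expect_docc_singleton y] at h
  linarith

/-- **Scaling**: `e_{Φ_V}(ω) = V · W(ω)` with `W(ω) = e_{Φ_1}(ω)` (any range parameter).
[cite: BratteliKishimotoRobinson1978, §3 (mean energy functional)] -/
theorem meanEnergy_nnRepulsion_eq_mul (V R : ℝ) :
    ω.meanEnergy (nnRepulsionFermionInteraction d V) R = V * ω.meanEnergy (nnRepulsionFermionInteraction d 1) R := by
  have h : ∀ X, (nnRepulsionFermionInteraction d V).Φ X = (V : ℂ) • (nnRepulsionFermionInteraction d 1).Φ X := by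
    intro X
    have h1 := nnRepulsionFermionInteraction_smul_apply (d := d) V 1 X
    rwa [mul_one] at h1
  unfold InfVolFermionState.meanEnergy
  rw [FermionInteraction.meanEnergyObs_of_smul h, map_smul, smul_eq_mul, Complex.re_ofReal_mul]

/-- **The mean energy of the nearest-neighbour repulsion does not depend on the range parameter**
`R ≥ 1` (its bonds through the origin lie in `[-1,1]^d`). [cite: BratteliKishimotoRobinson1978, §3 (mean energy functional)] -/
theorem meanEnergy_nnRepulsion_eq_one (V : ℝ) {R : ℝ} (hR : 1 ≤ R) :
    ω.meanEnergy (nnRepulsionFermionInteraction d V) R = ω.meanEnergy (nnRepulsionFermionInteraction d V) 1 := by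
  refine ω.meanEnergy_eq_of_le _ hR fun X h0 hX => ?_
  by_cases hpair : ∃ (x : Site d) (i : Fin d), X = {x, x + unitVec i}
  · exfalso
    obtain ⟨x, i, rfl⟩ := hpair
    rw [mem_insert, mem_singleton] at h0
    rcases h0 with h0 | h0
    · subst h0
      exact hX (pair_unitVec_subset_thicken_one i)
    · have hx : x = -unitVec i := eq_neg_of_add_eq_zero_left h0.symm
      subst hx
      exact hX (pair_neg_unitVec_subset_thicken_one i)
  · push Not at hpair
    exact nnRepulsionFermionInteraction_apply_eq_zero V hpair

/-- The real part of `(2 : ℂ)⁻¹ • z` is one half of the real part of `z`. [folklore] -/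
private theorem re_half_smul (z : ℂ) : ((2 : ℂ)⁻¹ • z).re = z.re / 2 := by
  rw [smul_eq_mul, Complex.mul_re]
  simp [Complex.inv_re, Complex.inv_im]
  ring

/-- **`W(ω) ≥ 0` for EVERY state**: the nearest-neighbour density–density energy per site
`W(ω) = e_{Φ_1}(ω)` is nonnegative (each bond term is a sum of projections); hence `e_{Φ_V}(ω) ≥ 0`
for `V ≥ 0` — the infinite-volume face of `V̂ ⪰ 0`. [cite: BratteliRobinsonI1987, §2.3.2] -/
theorem meanEnergy_nnRepulsion_one_nonneg : 0 ≤ ω.meanEnergy (nnRepulsionFermionInteraction d 1) 1 := by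
  unfold InfVolFermionState.meanEnergy
  rw [nnRepulsionFermionInteraction_meanEnergyObs, map_sum, Complex.re_sum]
  refine Finset.sum_nonneg fun i _ => ?_
  rw [map_add, map_smul, map_smul, ω.compatible, ω.compatible, Complex.add_re, re_half_smul, re_half_smul,
    nnRepulsionFermionInteraction_apply_pair 1 (0 : Site d) i,
    nnRepulsionFermionInteraction_apply_pair 1 (-unitVec i : Site d) i, Complex.ofReal_one, one_smul,
    one_smul]
  have h1 := ω.re_expect_density_mul_density_nonneg (Λ := ({0, 0 + unitVec i} : Finset (Site d)))
    (mem_insert_self _ _) (mem_insert_of_mem (mem_singleton_self _))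
  have h2 := ω.re_expect_density_mul_density_nonneg
    (Λ := ({-unitVec i, -unitVec i + unitVec i} : Finset (Site d)))
    (mem_insert_self _ _) (mem_insert_of_mem (mem_singleton_self _))
  linarith

/-- `e_{Φ_V}(ω) ≥ 0` for `V ≥ 0` and every state. [cite: BratteliRobinsonI1987, §2.3.2] -/
theorem meanEnergy_nnRepulsion_nonneg {V : ℝ} (hV : 0 ≤ V) :
    0 ≤ ω.meanEnergy (nnRepulsionFermionInteraction d V) 1 := by
  rw [ω.meanEnergy_nnRepulsion_eq_mul V 1]
  exact mul_nonneg hV ω.meanEnergy_nnRepulsion_one_nonneg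

/-- **KINEMATIC CAP OF THE CONJUGATE DENSITY**: for every translation-invariant state on `ℤ^d`,
`W(ω) ≤ d · (ρ(ω) + 2 D(ω))`, `D(ω) = Re ω(n_{0↑}n_{0↓})` (`2d` half bonds through the origin, each
`≤ ½(ρ + 2D)` by `2 n_x n_y ≤ n_x² + n_y²`, `n_x² = n_x + 2n_{x↑}n_{x↓}`). With a certified docc CEILING
this is the «docc-word edition» of the nearest-neighbour word. [cite: KomaTasaki1994, §1] -/
theorem IsTranslationInvariant.meanEnergy_nnRepulsion_one_le {ω : InfVolFermionState d}
    (hω : ω.IsTranslationInvariant) :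
    ω.meanEnergy (nnRepulsionFermionInteraction d 1) 1 ≤
      d * (ω.density + 2 * (ω.expect {0} (nAt (0 : Site d) (mem_singleton_self 0) 0 * nAt 0 (mem_singleton_self 0) 1)).re) := by
  unfold InfVolFermionState.meanEnergy
  rw [nnRepulsionFermionInteraction_meanEnergyObs, map_sum, Complex.re_sum]
  have hterm : ∀ i ∈ (univ : Finset (Fin d)),
      (ω.expect _ (((2 : ℂ)⁻¹ • fermionEmbed (PolySite.incl (pair_unitVec_subset_thicken_one i))
            ((nnRepulsionFermionInteraction d 1).Φ {0, 0 + unitVec i}) +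
          (2 : ℂ)⁻¹ • fermionEmbed (PolySite.incl (pair_neg_unitVec_subset_thicken_one i))
            ((nnRepulsionFermionInteraction d 1).Φ {-unitVec i, -unitVec i + unitVec i})))).re ≤
        ω.density + 2 * (ω.expect {0} (nAt (0 : Site d) (mem_singleton_self 0) 0 * nAt 0 (mem_singleton_self 0) 1)).re := by
    intro i _
    rw [map_add, map_smul, map_smul, ω.compatible, ω.compatible, Complex.add_re, re_half_smul, re_half_smul,
      nnRepulsionFermionInteraction_apply_pair 1 (0 : Site d) i,
      nnRepulsionFermionInteraction_apply_pair 1 (-unitVec i : Site d) i, Complex.ofReal_one, one_smul,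
      one_smul]
    have h1 := hω.re_expect_density_mul_density_le (Λ := ({0, 0 + unitVec i} : Finset (Site d)))
      (mem_insert_self _ _) (mem_insert_of_mem (mem_singleton_self _))
    have h2 := hω.re_expect_density_mul_density_le
      (Λ := ({-unitVec i, -unitVec i + unitVec i} : Finset (Site d)))
      (mem_insert_self _ _) (mem_insert_of_mem (mem_singleton_self _))
    linarith
  refine (Finset.sum_le_sum hterm).trans ?_
  rw [Finset.sum_const, Finset.card_univ, Fintype.card_fin, nsmul_eq_mul]

/-- **The bond term expectation does not depend on the bond** (translation-invariant `ω`):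
`ω(Φ_V{x, x + e_i}) = ω(Φ_V{0, e_i})`. [cite: BratteliRobinsonI1987, §4.3.1] -/
theorem IsTranslationInvariant.expect_nnRepulsion_pair {ω : InfVolFermionState d}
    (hω : ω.IsTranslationInvariant) (V : ℝ) (x : Site d) (i : Fin d) :
    ω.expect {x, x + unitVec i} ((nnRepulsionFermionInteraction d V).Φ {x, x + unitVec i}) =
      ω.expect {0, 0 + unitVec i} ((nnRepulsionFermionInteraction d V).Φ {0, 0 + unitVec i}) := by
  conv_rhs => rw [← hω x, shift_expect]
  refine ω.expect_fermionEmbed_incl_eq (subset_refl _) (shiftSet_pair_zero_subset x i) _ _ ?_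
  have hp0 : ∀ (h : 0 + x ∈ ({x, x + unitVec i} : Finset (Site d)))
      (h' : x ∈ ({x, x + unitVec i} : Finset (Site d))),
      (PolySite.pt (0 + x) h : PolySite ({x, x + unitVec i} : Finset (Site d))) = PolySite.pt x h' :=
    fun h h' => Subtype.ext (congrArg toLex (zero_add x))
  have hp1 : ∀ (h : 0 + unitVec i + x ∈ ({x, x + unitVec i} : Finset (Site d)))
      (h' : x + unitVec i ∈ ({x, x + unitVec i} : Finset (Site d))),
      (PolySite.pt (0 + unitVec i + x) h : PolySite ({x, x + unitVec i} : Finset (Site d))) =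
        PolySite.pt (x + unitVec i) h' :=
    fun h h' => Subtype.ext (congrArg toLex (by rw [zero_add, add_comm]))
  simp only [nnRepulsionFermionInteraction_apply_pair, nAt, fermionEmbed_smul, map_add, map_mul,
    fermionEmbed_numberOp, PolySite.shiftEmb_pt, PolySite.incl_pt, hp0 _ (mem_insert_self _ _),
    hp1 _ (mem_insert_of_mem (mem_singleton_self _))]

/-- **DICTIONARY: the conjugate density as an explicit correlator.** For translation-invariant `ω`,
`W(ω) = Σ_i Re ω(n_0 n_{e_i})`, the sum over the `d` axes of the nearest-neighbour density–density
correlator in the two-site region `{0, e_i}` (the form in which a certificate engine certifies a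
nearest-neighbour word `W ≤ Whi`). [cite: BratteliKishimotoRobinson1978, §3 (mean energy functional)] -/
theorem IsTranslationInvariant.meanEnergy_nnRepulsion_one_eq_sum {ω : InfVolFermionState d}
    (hω : ω.IsTranslationInvariant) :
    ω.meanEnergy (nnRepulsionFermionInteraction d 1) 1 =
      ∑ i : Fin d, (ω.expect {0, 0 + unitVec i}
        ((nAt 0 (mem_insert_self _ _) 0 + nAt 0 (mem_insert_self _ _) 1) *
          (nAt (0 + unitVec i) (mem_insert_of_mem (mem_singleton_self _)) 0 +
            nAt (0 + unitVec i) (mem_insert_of_mem (mem_singleton_self _)) 1))).re := by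
  unfold InfVolFermionState.meanEnergy
  rw [nnRepulsionFermionInteraction_meanEnergyObs, map_sum, Complex.re_sum]
  refine Finset.sum_congr rfl fun i _ => ?_
  have hpair := hω.expect_nnRepulsion_pair 1 (-unitVec i) i
  rw [map_add, map_smul, map_smul, ω.compatible, ω.compatible, Complex.add_re, re_half_smul, re_half_smul,
    hpair, nnRepulsionFermionInteraction_apply_pair 1 (0 : Site d) i, Complex.ofReal_one, one_smul]
  ring

end InfVolFermionState

end ConjugateDensity

/-- **Class-wide bracket on `ℤ²`**: for every translation-invariant state, `0 ≤ W(ω) ≤ 4ρ(ω)`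
(`W ≤ 2(ρ + 2D)` and `D ≤ ρ/2`). [cite: Ruelle1969, §3.4] -/
theorem InfVolFermionState.IsTranslationInvariant.meanEnergy_nnRepulsion_one_mem_Icc
    {ω : InfVolFermionState 2} (hω : ω.IsTranslationInvariant) :
    ω.meanEnergy (nnRepulsionFermionInteraction 2 1) 1 ∈ Set.Icc 0 (4 * ω.density) := by
  refine ⟨ω.meanEnergy_nnRepulsion_one_nonneg, ?_⟩
  have h := hω.meanEnergy_nnRepulsion_one_le
  have hD := ω.meanEnergy_hubbardTTPrime_onSite_le_half_density
  rw [ω.meanEnergy_hubbardTTPrime_onSite_eq_re_expect_docc] at hD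
  have h2 : ((2 : ℕ) : ℝ) = 2 := by norm_num
  rw [h2] at h
  linarith

/-! ### §3. The extended `t–t'–U–V` Hubbard interaction of the square lattice -/

section TTPrimeV

/-- **The extended `t–t'–U–V` Hubbard interaction on `ℤ²`**: nearest-neighbour hopping `t`, diagonal
hopping `t'`, on-site repulsion `U`, nearest-neighbour repulsion `V` — by DEFINITION the pencil
`Φ(t,t',U) + V · Φ_1` of the `t–t'` interaction and the unit-amplitude nearest-neighbour density–density
interaction (so `Φ {x} = U n_{x↑}n_{x↓}`, `Φ {x, x+e_i} = −tΣ_σ(c†c + h.c.) + V n_x n_{x+e_i}`,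
`Φ {x, x+e₁±e₂} = −t'Σ_σ(…)`, `Φ X = 0` otherwise): Schüler et al. (2013) Eq. (1) with
`V_ij = V` on nearest-neighbour bonds and `0` beyond. [cite: SchulerEtAl2013, Eq. (1)] -/
def hubbardTT'VFermionInteraction (t t' U V : ℝ) : FermionInteraction 2 :=
  (hubbardTTPrimeFermionInteraction t t' U).pencil (nnRepulsionFermionInteraction 2 1) V

variable (t t' U V : ℝ)

/-- The terms of the extended interaction: `Φ X = Φ^{t,t',U} X + Φ_V X`. [cite: SchulerEtAl2013, Eq. (1)] -/
theorem hubbardTT'VFermionInteraction_apply (X : Finset (Site 2)) :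
    (hubbardTT'VFermionInteraction t t' U V).Φ X =
      (hubbardTTPrimeFermionInteraction t t' U).Φ X + (nnRepulsionFermionInteraction 2 V).Φ X := by
  rw [hubbardTT'VFermionInteraction, FermionInteraction.pencil_apply, ← nnRepulsionFermionInteraction_smul_apply,
    mul_one]

/-- **The extended interaction is even.** [cite: ArakiMoriya2003, §5.1] -/
theorem hubbardTT'VFermionInteraction_isEven : (hubbardTT'VFermionInteraction t t' U V).IsEven :=
  FermionInteraction.isEven_pencil (hubbardTTPrimeFermionInteraction_isEven t t' U)
    (nnRepulsionFermionInteraction_isEven 1) V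

/-- **The extended interaction is Hermitian** (real couplings). [cite: SchulerEtAl2013, Eq. (1)] -/
theorem hubbardTT'VFermionInteraction_isHermitian : (hubbardTT'VFermionInteraction t t' U V).IsHermitian :=
  FermionInteraction.isHermitian_pencil (hubbardTTPrimeFermionInteraction_isHermitian t t' U)
    (nnRepulsionFermionInteraction_isHermitian 1) V

/-- **At `V = 0` the extended interaction IS the `t–t'` interaction.** [cite: SchulerEtAl2013, Eq. (1)] -/
theorem hubbardTT'VFermionInteraction_zero :
    hubbardTT'VFermionInteraction t t' U 0 = hubbardTTPrimeFermionInteraction t t' U :=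
  FermionInteraction.ext fun X => FermionInteraction.pencil_zero_apply _ _ X

/-- On-site term: `Φ {x} = U n_{x↑} n_{x↓}` (the repulsion `V` has no on-site part). [cite: SchulerEtAl2013, Eq. (1)] -/
theorem hubbardTT'VFermionInteraction_apply_singleton (x : Site 2) :
    (hubbardTT'VFermionInteraction t t' U V).Φ {x} =
      (U : ℂ) • (nAt x (mem_singleton_self x) 0 * nAt x (mem_singleton_self x) 1) := by
  rw [hubbardTT'VFermionInteraction_apply, hubbardTTPrimeFermionInteraction_apply_singleton,
    nnRepulsionFermionInteraction_apply_singleton, add_zero]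

/-- Nearest-neighbour bond term: the Hubbard hopping bond plus `V n_x n_{x+e_i}`.
[cite: SchulerEtAl2013, Eq. (1)] -/
theorem hubbardTT'VFermionInteraction_apply_pair_unitVec (x : Site 2) (i : Fin 2) :
    (hubbardTT'VFermionInteraction t t' U V).Φ {x, x + unitVec i} =
      (hubbardFermionInteraction 2 t U).Φ {x, x + unitVec i} +
        (V : ℂ) • ((nAt x (mem_insert_self _ _) 0 + nAt x (mem_insert_self _ _) 1) *
          (nAt (x + unitVec i) (mem_insert_of_mem (mem_singleton_self _)) 0 +
            nAt (x + unitVec i) (mem_insert_of_mem (mem_singleton_self _)) 1)) := by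
  rw [hubbardTT'VFermionInteraction_apply, hubbardTTPrimeFermionInteraction_apply_pair_unitVec,
    nnRepulsionFermionInteraction_apply_pair]

/-- The mean-energy observable splits: `E^{tt'UV} = E^{tt'U} + V · E^{Φ_1}`.
[cite: BratteliKishimotoRobinson1978, §3 (mean energy functional)] -/
theorem hubbardTT'VFermionInteraction_meanEnergyObs (R : ℝ) :
    (hubbardTT'VFermionInteraction t t' U V).meanEnergyObs R =
      (hubbardTTPrimeFermionInteraction t t' U).meanEnergyObs R +
        (V : ℂ) • (nnRepulsionFermionInteraction 2 1).meanEnergyObs R :=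
  FermionInteraction.meanEnergyObs_pencil _ _ V R

/-- **The mean energy of a state is affine in `V`**: `e^{tt'UV}(ω) = e^{tt'U}(ω) + V · W(ω)`, `W(ω)`
the nearest-neighbour density–density energy per site of `ω`.
[cite: BratteliKishimotoRobinson1978, §3 (mean energy functional)] -/
theorem InfVolFermionState.meanEnergy_hubbardTT'V (ω : InfVolFermionState 2) (R : ℝ) :
    ω.meanEnergy (hubbardTT'VFermionInteraction t t' U V) R =
      ω.meanEnergy (hubbardTTPrimeFermionInteraction t t' U) R +
        V * ω.meanEnergy (nnRepulsionFermionInteraction 2 1) R :=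
  ω.meanEnergy_pencil _ _ V R

/-- **… and affine in `U`** (range parameter `1`): `e^{tt'UV}(ω) = e^{tt'U₀V}(ω) + (U − U₀) · D(ω)` with
`D(ω) = e_{Φ(0,0,1)}(ω) = Re ω(n_{0↑}n_{0↓})` the double-occupancy density.
[cite: BratteliKishimotoRobinson1978, §3 (mean energy functional)] -/
theorem InfVolFermionState.meanEnergy_hubbardTT'V_affine_U (ω : InfVolFermionState 2) (U₀ : ℝ) :
    ω.meanEnergy (hubbardTT'VFermionInteraction t t' U V) 1 =
      ω.meanEnergy (hubbardTT'VFermionInteraction t t' U₀ V) 1 +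
        (U - U₀) * ω.meanEnergy (hubbardTTPrimeFermionInteraction 0 0 1) 1 := by
  rw [ω.meanEnergy_hubbardTT'V, ω.meanEnergy_hubbardTT'V, ω.meanEnergy_hubbardTTPrime_affine t t' U₀ t' U,
    sub_self, zero_mul, add_zero]
  ring

end TTPrimeV

/-! ### §4 (appended). The particle–hole floor of the conjugate density: `W(ω) ≥ 4d(ρ − 1)` -/

section ParticleHoleFloor

namespace InfVolFermionState

variable (ω : InfVolFermionState d)

/-- The site density read in a larger region: `Re ω_Λ(n_{x↑} + n_{x↓}) = ρ(x)`. [cite: ArakiMoriya2003, §4.1] -/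
theorem re_expect_density_eq_densityAt {Λ : Finset (Site d)} {x : Site d} (hx : x ∈ Λ) :
    (ω.expect Λ (nAt x hx 0 + nAt x hx 1)).re = ω.densityAt x := by
  rw [map_add, ω.expect_nAt_eq_singleton hx, ω.expect_nAt_eq_singleton hx, InfVolFermionState.densityAt,
    map_add]

/-- **`Re ω(n_x n_y) ≥ 2ρ(x) + 2ρ(y) − 4`** for every state and any two sites of a region: the hole
product `(2 − n_x)(2 − n_y)` is the sum of the four commuting projections `(1 − n_{xσ})(1 − n_{yτ})`.
[cite: BratteliRobinsonI1987, §2.3.2] -/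
theorem re_expect_density_mul_density_ge {Λ : Finset (Site d)} {x y : Site d} (hx : x ∈ Λ) (hy : y ∈ Λ) :
    2 * ω.densityAt x + 2 * ω.densityAt y - 4 ≤
      (ω.expect Λ ((nAt x hx 0 + nAt x hx 1) * (nAt y hy 0 + nAt y hy 1))).re := by
  have hP : ∀ σ τ : Fin 2, 0 ≤ 1 - (ω.expect Λ (nAt x hx σ)).re - (ω.expect Λ (nAt y hy τ)).re +
      (ω.expect Λ (nAt x hx σ * nAt y hy τ)).re := by
    intro σ τ
    have hc : Commute (1 - nAt x hx σ) (1 - nAt y hy τ) :=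
      (Commute.one_left _).sub_left ((Commute.one_right _).sub_right (commute_nAt hx hy σ τ))
    have h := isHermitian_isIdempotentElem_mul_of_commute hc
      (Matrix.isHermitian_one.sub (isHermitian_nAt hx σ)) (isIdempotentElem_nAt hx σ).one_sub
      (Matrix.isHermitian_one.sub (isHermitian_nAt hy τ)) (isIdempotentElem_nAt hy τ).one_sub
    have h0 := ω.re_expect_nonneg_of_isHermitian_of_isIdempotentElem Λ h.1 h.2
    rw [sub_mul, one_mul, mul_sub, mul_one, map_sub, map_sub, map_sub, ω.expect_one, Complex.sub_re,
      Complex.sub_re, Complex.sub_re, Complex.one_re] at h0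
    linarith
  have hx' := ω.re_expect_density_eq_densityAt hx
  have hy' := ω.re_expect_density_eq_densityAt hy
  rw [map_add, Complex.add_re] at hx' hy'
  rw [add_mul, mul_add, mul_add, map_add, map_add, map_add, Complex.add_re, Complex.add_re, Complex.add_re]
  have h00 := hP 0 0
  have h01 := hP 0 1
  have h10 := hP 1 0
  have h11 := hP 1 1
  linarith

/-- **`Re ω(n_x n_y) ≥ 4ρ − 4` for translation-invariant `ω`** (informative above half filling).
[cite: Ruelle1969, §3.4] -/
theorem IsTranslationInvariant.re_expect_density_mul_density_ge {ω : InfVolFermionState d}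
    (hω : ω.IsTranslationInvariant) {Λ : Finset (Site d)} {x y : Site d} (hx : x ∈ Λ) (hy : y ∈ Λ) :
    4 * ω.density - 4 ≤ (ω.expect Λ ((nAt x hx 0 + nAt x hx 1) * (nAt y hy 0 + nAt y hy 1))).re := by
  have h := ω.re_expect_density_mul_density_ge hx hy
  rw [hω.densityAt_eq_density x, hω.densityAt_eq_density y] at h
  linarith

/-- **PARTICLE–HOLE FLOOR OF THE CONJUGATE DENSITY**: for every translation-invariant state on `ℤ^d`,
`d·(4ρ(ω) − 4) ≤ W(ω)` — each of the `2d` half bonds through the origin carries `Re ω(n_x n_y) ≥ 4ρ − 4`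
(the hole product `(2 − n_x)(2 − n_y) ⪰ 0`). Together with `W ≥ 0` this is the exact mirror, under
particle–hole conjugation, of the kinematic caps; it makes the `V`-increment of the extended model's energy
STRICTLY POSITIVE above half filling (electron-doped side). [cite: Ruelle1969, §3.4] -/
theorem IsTranslationInvariant.le_meanEnergy_nnRepulsion_one {ω : InfVolFermionState d}
    (hω : ω.IsTranslationInvariant) :
    d * (4 * ω.density - 4) ≤ ω.meanEnergy (nnRepulsionFermionInteraction d 1) 1 := by
  unfold InfVolFermionState.meanEnergy
  rw [nnRepulsionFermionInteraction_meanEnergyObs, map_sum, Complex.re_sum]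
  have hterm : ∀ i ∈ (univ : Finset (Fin d)),
      4 * ω.density - 4 ≤
        (ω.expect _ (((2 : ℂ)⁻¹ • fermionEmbed (PolySite.incl (pair_unitVec_subset_thicken_one i))
            ((nnRepulsionFermionInteraction d 1).Φ {0, 0 + unitVec i}) +
          (2 : ℂ)⁻¹ • fermionEmbed (PolySite.incl (pair_neg_unitVec_subset_thicken_one i))
            ((nnRepulsionFermionInteraction d 1).Φ {-unitVec i, -unitVec i + unitVec i})))).re := by
    intro i _
    rw [map_add, map_smul, map_smul, ω.compatible, ω.compatible, Complex.add_re, re_half_smul, re_half_smul,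
      nnRepulsionFermionInteraction_apply_pair 1 (0 : Site d) i,
      nnRepulsionFermionInteraction_apply_pair 1 (-unitVec i : Site d) i, Complex.ofReal_one, one_smul,
      one_smul]
    have h1 := hω.re_expect_density_mul_density_ge (Λ := ({0, 0 + unitVec i} : Finset (Site d)))
      (mem_insert_self _ _) (mem_insert_of_mem (mem_singleton_self _))
    have h2 := hω.re_expect_density_mul_density_ge
      (Λ := ({-unitVec i, -unitVec i + unitVec i} : Finset (Site d)))
      (mem_insert_self _ _) (mem_insert_of_mem (mem_singleton_self _))
    linarith
  refine le_trans ?_ (Finset.sum_le_sum hterm)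
  rw [Finset.sum_const, Finset.card_univ, Fintype.card_fin, nsmul_eq_mul]

/-- **On `ℤ²`: `8(ρ − 1) ≤ W(ω)`** for every translation-invariant state. [cite: Ruelle1969, §3.4] -/
theorem IsTranslationInvariant.eight_mul_le_meanEnergy_nnRepulsion_one {ω : InfVolFermionState 2}
    (hω : ω.IsTranslationInvariant) :
    8 * (ω.density - 1) ≤ ω.meanEnergy (nnRepulsionFermionInteraction 2 1) 1 := by
  have h := hω.le_meanEnergy_nnRepulsion_one
  have h2 : ((2 : ℕ) : ℝ) = 2 := by norm_num
  rw [h2] at h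
  linarith

/-- **The full class-wide bracket on `ℤ²`**: `max(0, 8(ρ − 1)) ≤ W(ω) ≤ 4ρ` for every translation-invariant
state (both ends are attained at `ρ = 2`: `W = 8`). [cite: Ruelle1969, §3.4] -/
theorem IsTranslationInvariant.meanEnergy_nnRepulsion_one_mem_Icc_max {ω : InfVolFermionState 2}
    (hω : ω.IsTranslationInvariant) :
    ω.meanEnergy (nnRepulsionFermionInteraction 2 1) 1 ∈ Set.Icc (max 0 (8 * (ω.density - 1))) (4 * ω.density) :=
  ⟨max_le ω.meanEnergy_nnRepulsion_one_nonneg hω.eight_mul_le_meanEnergy_nnRepulsion_one,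
    hω.meanEnergy_nnRepulsion_one_mem_Icc.2⟩

end InfVolFermionState

end ParticleHoleFloor

end Literature.MathematicalPhysics.QuantumLattice

end
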